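import Mathlib
import Summits.Ventures.HodgeRepro2.DiscMeanValue

/-!
# PolydiscMeanValue — the mean value property of holomorphic functions on a polydisc in `ℂ²`

Blind cell `pub-hodge-repro2`, seat p2 (Tier 5 kernel support: towards the finite-dimensionality
of the space of holomorphic weight-`k` forms on the compact Picard modular surface).

The ball `𝔹²` of this cell lives in `Fin 2 → ℂ` with the SUP norm, so a metric ball `ball z r` of
`Fin 2 → ℂ` is the polydisc `{w | ‖w 0 - z 0‖ < r ∧ ‖w 1 - z 1‖ < r}`. For `f` holomorphic on the
open polydisc and continuous on the closed one, Fubini (`volume_preserving_finTwoArrow`,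
`setIntegral_prod`) and the one-variable area mean value property (`DiscMeanValue.lean`) applied
to the two slices give

* `integral_ball_eq_pi_sq_smul`: `∫_{ball z r} f = (πr²)² · f z`;
* `norm_sq_le_integral_ball`: `‖f z‖² ≤ (πr²)⁻² ∫_{ball z r} ‖f‖²`.

Mathlib + `DiscMeanValue` only.
-/

namespace Summit.Ventures.HodgeRepro2.PolydiscMeanValue

open MeasureTheory Metric Real Set
open scoped Real

/-- The two-variable slice map `(x, y) ↦ ![x, y]` is `finTwoArrow.symm`. -/
theorem finTwoArrow_symm_apply' (p : ℂ × ℂ) :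
    (MeasurableEquiv.finTwoArrow.symm p : Fin 2 → ℂ) = ![p.1, p.2] := rfl

/-- `![z 0, z 1] = z`. -/
theorem vec_apply_self (z : Fin 2 → ℂ) : ![z 0, z 1] = z := by
  ext i
  fin_cases i <;> rfl

/-- The polydisc is the product of the two discs, through `finTwoArrow.symm`. -/
theorem preimage_finTwoArrow_symm_ball (z : Fin 2 → ℂ) {r : ℝ} (hr : 0 < r) :
    MeasurableEquiv.finTwoArrow.symm ⁻¹' ball z r = ball (z 0) r ×ˢ ball (z 1) r := by
  ext p
  simp only [mem_preimage, finTwoArrow_symm_apply', mem_ball, dist_eq_norm, mem_prod]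
  rw [pi_norm_lt_iff hr, Fin.forall_fin_two]
  simp

/-- A vector `![x, y]` with `‖x - z 0‖ ≤ r` and `‖y - z 1‖ ≤ r` lies in the closed polydisc. -/
theorem vec_mem_closedBall {z : Fin 2 → ℂ} {r : ℝ} (hr : 0 ≤ r) {x y : ℂ}
    (hx : x ∈ closedBall (z 0) r) (hy : y ∈ closedBall (z 1) r) : ![x, y] ∈ closedBall z r := by
  rw [mem_closedBall, dist_eq_norm, pi_norm_le_iff_of_nonneg hr, Fin.forall_fin_two]
  rw [mem_closedBall, dist_eq_norm] at hx hy
  exact ⟨hx, hy⟩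

variable {f : (Fin 2 → ℂ) → ℂ} {z : Fin 2 → ℂ} {r : ℝ}

/-- The slice `y ↦ f ![x, y]` is holomorphic on the disc and continuous on the closed disc, for
`x` in the closed disc. -/
theorem diffContOnCl_slice_right (hf : DiffContOnCl ℂ f (ball z r)) (hr : 0 < r) {x : ℂ}
    (hx : x ∈ ball (z 0) r) : DiffContOnCl ℂ (fun y => f ![x, y]) (ball (z 1) r) := by
  have hvec : Differentiable ℂ (fun y : ℂ => (![x, y] : Fin 2 → ℂ)) := by
    refine differentiable_pi.mpr ?_
    intro i
    fin_cases i
    · exact differentiable_const _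
    · exact differentiable_id
  refine ⟨?_, ?_⟩
  · refine hf.differentiableOn.comp hvec.differentiableOn fun y hy => ?_
    rw [mem_ball, dist_eq_norm, pi_norm_lt_iff hr, Fin.forall_fin_two]
    rw [mem_ball, dist_eq_norm] at hx hy
    exact ⟨hx, hy⟩
  · rw [closure_ball _ hr.ne']
    refine hf.continuousOn.comp hvec.continuous.continuousOn fun y hy => ?_
    rw [closure_ball _ hr.ne']
    exact vec_mem_closedBall hr.le (ball_subset_closedBall hx) hy

/-- The slice `x ↦ f ![x, z 1]` is holomorphic on the disc and continuous on the closed disc. -/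
theorem diffContOnCl_slice_left (hf : DiffContOnCl ℂ f (ball z r)) (hr : 0 < r) :
    DiffContOnCl ℂ (fun x => f ![x, z 1]) (ball (z 0) r) := by
  have hvec : Differentiable ℂ (fun x : ℂ => (![x, z 1] : Fin 2 → ℂ)) := by
    refine differentiable_pi.mpr ?_
    intro i
    fin_cases i
    · exact differentiable_id
    · exact differentiable_const _
  refine ⟨?_, ?_⟩
  · refine hf.differentiableOn.comp hvec.differentiableOn fun x hx => ?_
    rw [mem_ball, dist_eq_norm, pi_norm_lt_iff hr, Fin.forall_fin_two]
    rw [mem_ball, dist_eq_norm] at hx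
    exact ⟨hx, by simpa using hr⟩
  · rw [closure_ball _ hr.ne']
    refine hf.continuousOn.comp hvec.continuous.continuousOn fun x hx => ?_
    rw [closure_ball _ hr.ne']
    exact vec_mem_closedBall hr.le hx (mem_closedBall_self hr.le)

/-- The integrand of the product form is integrable on the product of the two discs. -/
theorem integrableOn_prod (hf : DiffContOnCl ℂ f (ball z r)) (hr : 0 < r) :
    IntegrableOn (fun p : ℂ × ℂ => f ![p.1, p.2]) (ball (z 0) r ×ˢ ball (z 1) r) volume := by
  have hcont : ContinuousOn f (closedBall z r) := by
    simpa [closure_ball z hr.ne'] using hf.continuousOn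
  obtain ⟨M, hM⟩ := (isCompact_closedBall z r).exists_bound_of_continuousOn hcont
  have hmeas : MeasurableSet (ball (z 0) r ×ˢ ball (z 1) r) :=
    measurableSet_ball.prod measurableSet_ball
  have hvec : Continuous (fun p : ℂ × ℂ => (![p.1, p.2] : Fin 2 → ℂ)) := by
    refine continuous_pi fun i => ?_
    fin_cases i
    · exact continuous_fst
    · exact continuous_snd
  have hmaps : ∀ p ∈ ball (z 0) r ×ˢ ball (z 1) r, (![p.1, p.2] : Fin 2 → ℂ) ∈ closedBall z r :=
    fun p hp => vec_mem_closedBall hr.le (ball_subset_closedBall hp.1) (ball_subset_closedBall hp.2)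
  have hcf : ContinuousOn (fun p : ℂ × ℂ => f ![p.1, p.2]) (ball (z 0) r ×ˢ ball (z 1) r) :=
    hcont.comp hvec.continuousOn hmaps
  have hfin : volume (ball (z 0) r ×ˢ ball (z 1) r) ≠ ⊤ := by
    rw [Measure.volume_eq_prod, Measure.prod_prod]
    exact ENNReal.mul_ne_top measure_ball_lt_top.ne measure_ball_lt_top.ne
  haveI : IsFiniteMeasure (volume.restrict (ball (z 0) r ×ˢ ball (z 1) r)) :=
    isFiniteMeasure_restrict.mpr hfin
  refine memLp_one_iff_integrable.mp (MemLp.of_bound (hcf.aestronglyMeasurable hmeas) M ?_)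
  exact ae_restrict_of_forall_mem hmeas fun p hp => hM _ (hmaps p hp)

/-- The polydisc integral as an iterated integral over the two discs. -/
theorem setIntegral_ball_eq_prod (g : (Fin 2 → ℂ) → ℂ) (hr : 0 < r)
    (hg : IntegrableOn (fun p : ℂ × ℂ => g ![p.1, p.2]) (ball (z 0) r ×ˢ ball (z 1) r) volume) :
    ∫ w in ball z r, g w = ∫ x in ball (z 0) r, ∫ y in ball (z 1) r, g ![x, y] := by
  rw [← (volume_preserving_finTwoArrow ℂ).symm.setIntegral_preimage_emb
    MeasurableEquiv.finTwoArrow.symm.measurableEmbedding g (ball z r),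
    preimage_finTwoArrow_symm_ball z hr]
  simp only [finTwoArrow_symm_apply']
  rw [Measure.volume_eq_prod, setIntegral_prod _ (by rw [← Measure.volume_eq_prod]; exact hg)]

/-- **The polydisc mean value property**: for `f` holomorphic on the open polydisc `ball z r` of
`Fin 2 → ℂ` (sup norm) and continuous on the closed polydisc, `∫_{ball z r} f = (πr²)² · f z`. -/
theorem integral_ball_eq_pi_sq_smul (hf : DiffContOnCl ℂ f (ball z r)) (hr : 0 < r) :
    ∫ w in ball z r, f w = ((π * r ^ 2) ^ 2 : ℝ) • f z := by
  rw [setIntegral_ball_eq_prod f hr (integrableOn_prod hf hr)]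
  have hin : ∀ x ∈ ball (z 0) r,
      ∫ y in ball (z 1) r, f ![x, y] = (π * r ^ 2 : ℝ) • f ![x, z 1] := fun x hx =>
    DiscMeanValue.integral_ball_eq_pi_smul (diffContOnCl_slice_right hf hr hx) hr
  rw [setIntegral_congr_fun measurableSet_ball hin, integral_smul,
    DiscMeanValue.integral_ball_eq_pi_smul (diffContOnCl_slice_left hf hr) hr, vec_apply_self,
    smul_smul]
  congr 1
  ring

/-- **The `L²` polydisc mean value bound**: `‖f z‖² ≤ (πr²)⁻² ∫_{ball z r} ‖f‖²`. -/
theorem norm_sq_le_integral_ball (hf : DiffContOnCl ℂ f (ball z r)) (hr : 0 < r) :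
    ‖f z‖ ^ 2 ≤ ((π * r ^ 2) ^ 2)⁻¹ * ∫ w in ball z r, ‖f w‖ ^ 2 := by
  have hpos : 0 < π * r ^ 2 := by positivity
  -- integrability of `‖f‖²` on the product
  have hcont : ContinuousOn f (closedBall z r) := by
    simpa [closure_ball z hr.ne'] using hf.continuousOn
  obtain ⟨M, hM⟩ := (isCompact_closedBall z r).exists_bound_of_continuousOn hcont
  have hmeas : MeasurableSet (ball (z 0) r ×ˢ ball (z 1) r) :=
    measurableSet_ball.prod measurableSet_ball
  have hvec : Continuous (fun p : ℂ × ℂ => (![p.1, p.2] : Fin 2 → ℂ)) := by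
    refine continuous_pi fun i => ?_
    fin_cases i
    · exact continuous_fst
    · exact continuous_snd
  have hmaps : ∀ p ∈ ball (z 0) r ×ˢ ball (z 1) r, (![p.1, p.2] : Fin 2 → ℂ) ∈ closedBall z r :=
    fun p hp => vec_mem_closedBall hr.le (ball_subset_closedBall hp.1) (ball_subset_closedBall hp.2)
  have hcf : ContinuousOn (fun p : ℂ × ℂ => ‖f ![p.1, p.2]‖ ^ 2) (ball (z 0) r ×ˢ ball (z 1) r) :=
    ((hcont.comp hvec.continuousOn hmaps).norm).pow 2
  have hfin : volume (ball (z 0) r ×ˢ ball (z 1) r) ≠ ⊤ := by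
    rw [Measure.volume_eq_prod, Measure.prod_prod]
    exact ENNReal.mul_ne_top measure_ball_lt_top.ne measure_ball_lt_top.ne
  haveI : IsFiniteMeasure (volume.restrict (ball (z 0) r ×ˢ ball (z 1) r)) :=
    isFiniteMeasure_restrict.mpr hfin
  have hint : IntegrableOn (fun p : ℂ × ℂ => ‖f ![p.1, p.2]‖ ^ 2)
      (ball (z 0) r ×ˢ ball (z 1) r) volume := by
    refine memLp_one_iff_integrable.mp (MemLp.of_bound (hcf.aestronglyMeasurable hmeas) (M ^ 2) ?_)
    refine ae_restrict_of_forall_mem hmeas fun p hp => ?_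
    rw [Real.norm_eq_abs, abs_of_nonneg (by positivity)]
    exact pow_le_pow_left₀ (norm_nonneg _) (hM _ (hmaps p hp)) 2
  -- the iterated bound
  have hinner : ∀ x ∈ ball (z 0) r,
      ‖f ![x, z 1]‖ ^ 2 ≤ (π * r ^ 2)⁻¹ * ∫ y in ball (z 1) r, ‖f ![x, y]‖ ^ 2 := fun x hx =>
    DiscMeanValue.norm_sq_le_integral (diffContOnCl_slice_right hf hr hx) hr
  have houter : ‖f z‖ ^ 2 ≤ (π * r ^ 2)⁻¹ * ∫ x in ball (z 0) r, ‖f ![x, z 1]‖ ^ 2 := by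
    have := DiscMeanValue.norm_sq_le_integral (diffContOnCl_slice_left hf hr) hr
    simpa [vec_apply_self] using this
  -- the outer integrand is bounded by the inner integrals (Fubini for the square)
  have hprod : ∫ w in ball z r, ‖f w‖ ^ 2
      = ∫ x in ball (z 0) r, ∫ y in ball (z 1) r, ‖f ![x, y]‖ ^ 2 := by
    have hintC : IntegrableOn (fun p : ℂ × ℂ => ((‖f ![p.1, p.2]‖ ^ 2 : ℝ) : ℂ))
        (ball (z 0) r ×ˢ ball (z 1) r) volume := hint.ofReal
    have := setIntegral_ball_eq_prod (z := z) (fun w => ((‖f w‖ ^ 2 : ℝ) : ℂ)) hr hintC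
    -- pass from the complex-valued statement to the real one
    have h1 : ∫ w in ball z r, ((‖f w‖ ^ 2 : ℝ) : ℂ) = ((∫ w in ball z r, ‖f w‖ ^ 2 : ℝ) : ℂ) :=
      integral_complex_ofReal
    have h2 : ∫ x in ball (z 0) r, ∫ y in ball (z 1) r, ((‖f ![x, y]‖ ^ 2 : ℝ) : ℂ)
        = ((∫ x in ball (z 0) r, ∫ y in ball (z 1) r, ‖f ![x, y]‖ ^ 2 : ℝ) : ℂ) := by
      simp only [integral_complex_ofReal]
    rw [h1, h2] at this
    exact_mod_cast this
  -- integrability of the two real integrands on the outer disc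
  have hint_outer : IntegrableOn (fun x => ‖f ![x, z 1]‖ ^ 2) (ball (z 0) r) volume := by
    have hc : ContinuousOn (fun x => ‖f ![x, z 1]‖ ^ 2) (closedBall (z 0) r) := by
      have := (diffContOnCl_slice_left hf hr).continuousOn
      rw [closure_ball _ hr.ne'] at this
      exact this.norm.pow 2
    exact (hc.integrableOn_compact (isCompact_closedBall _ _)).mono_set ball_subset_closedBall
  have hint_inner : IntegrableOn (fun x => ∫ y in ball (z 1) r, ‖f ![x, y]‖ ^ 2)
      (ball (z 0) r) volume := by
    have h := hint
    rw [IntegrableOn, Measure.volume_eq_prod, ← Measure.prod_restrict] at h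
    exact h.integral_prod_left
  calc ‖f z‖ ^ 2 ≤ (π * r ^ 2)⁻¹ * ∫ x in ball (z 0) r, ‖f ![x, z 1]‖ ^ 2 := houter
    _ ≤ (π * r ^ 2)⁻¹ * ∫ x in ball (z 0) r,
          (π * r ^ 2)⁻¹ * ∫ y in ball (z 1) r, ‖f ![x, y]‖ ^ 2 := by
        refine mul_le_mul_of_nonneg_left ?_ (inv_pos.mpr hpos).le
        exact setIntegral_mono_on hint_outer (hint_inner.const_mul _) measurableSet_ball hinner
    _ = ((π * r ^ 2) ^ 2)⁻¹ * ∫ w in ball z r, ‖f w‖ ^ 2 := by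
        rw [integral_const_mul, hprod]
        ring

end Summit.Ventures.HodgeRepro2.PolydiscMeanValue
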